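import Literature.Algebra.EuclideanLattices.GramSchmidtTablePrefix
import Literature.Algebra.EuclideanLattices.LLLRunBounds
import HarnessLib

/-!
# Cohen's integer Gram–Schmidt table on an ARBITRARY integer family: exactness one level past the independent prefix, vanishing, and a universal size bound

Topic `Algebra/EuclideanLattices`, sequel of `GramSchmidtTablePrefix.lean` (`uRec b l i j = dₗ ⟪bᵢ, πₗ bⱼ⟫`
for all levels `l ≤ L` when the first `L` vectors are independent). A machine that runs Cohen's
recursion (`LLLIntegral.uRec`, integer division `Int.ediv`, `x / 0 = 0`) on an input it cannot
trust to be independent — the reduction machine of the discharge of Aaronson–Arkhipov's Thm. 1.3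
(`Literature.Computability.QuantumComplexity.gpeSolvableInFBPPRel_NPRel_of_approxBosonSamplingOracle`)
runs it on coin-sampled columns — needs its registers polynomially bounded on EVERY input. They are,
with no saturation (contrast `LLLCapModel.lean`):

* `uRec_succ_cast_eq_gsU` — one exact step: if level `l` is exact and `dₗ ≥ 1` then level `l + 1`
  is exact (the step of `uRec_cast_eq_gsU_of_prefix`, isolated); hence
  `uRec_cast_eq_gsU_succ_prefix` — with an independent prefix of length `L < N`, level `L + 1` is
  STILL exact;
* `uRec_prefix_succ_eq_zero` — if moreover the first `L + 1` vectors are dependent, level `L + 1`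
  vanishes identically (`d_{L+1} = 0`), and `uRec_eq_zero_of_level_eq_zero` — zero levels propagate;
* **`abs_uRec_le_pow`** — for EVERY integer family with `‖bₖ‖² ≤ B` (`B ≥ 1`) and all `l, i, j`:
  `|uRec b l i j| ≤ B^{l+1}` (exact levels by `|dₗ ⟪bᵢ, πₗ bⱼ⟫| ≤ dₗ ‖bᵢ‖ ‖bⱼ‖ ≤ Bˡ · B`,
  `abs_gsU_le`, `gramDet_le_pow`; the others are `0`), and `abs_dRec_le_pow`.

All proved.

## References

* H. Cohen, *A Course in Computational Algebraic Number Theory*, GTM 138, Springer 1993, §2.6.3 and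
  Algorithm 2.6.7.
* A. K. Lenstra, H. W. Lenstra Jr., L. Lovász, *Factoring polynomials with rational coefficients*,
  Math. Ann. 261 (1982), proof of Prop. 1.26 (Hadamard bound `dᵢ ≤ Bⁱ`).
-/

noncomputable section

namespace Literature.Algebra.EuclideanLattices

open InnerProductSpace Finset
open scoped RealInnerProductSpace

variable {N m : ℕ}

/-- `uRec` vanishes past level `N` (junk value of the definition). [folklore] -/
theorem uRec_of_lt (b : Fin N → (Fin m → ℤ)) {l : ℕ} (hl : N ≤ l) (i j : Fin N) :
    uRec b (l + 1) i j = 0 := by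
  rw [uRec, dif_neg (not_lt.2 hl)]

/-- **One exact step of Cohen's recursion**: if level `l < N` is exact (`uₗ = dₗ ⟪bᵢ, πₗ bⱼ⟫`),
`dRec l = dₗ` and `dₗ ≥ 1`, then level `l + 1` is exact. [cite: Cohen1993, Algorithm 2.6.7] -/
theorem uRec_succ_cast_eq_gsU (b : Fin N → (Fin m → ℤ)) {l : ℕ} (hl : l < N)
    (hex : ∀ i j : Fin N, (uRec b l i j : ℝ) = gsU (⇑(intVecToEuclidean m).toAddMonoidHom ∘ b) l hl.le i j)
    (hden : (dRec b l : ℝ) = gramDet (⇑(intVecToEuclidean m).toAddMonoidHom ∘ b) l hl.le)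
    (hd : 1 ≤ gramDet (⇑(intVecToEuclidean m).toAddMonoidHom ∘ b) l hl.le) (i j : Fin N) :
    (uRec b (l + 1) i j : ℝ) = gsU (⇑(intVecToEuclidean m).toAddMonoidHom ∘ b) (l + 1) hl i j := by
  set f := ⇑(intVecToEuclidean m).toAddMonoidHom ∘ b with hf
  set Lf : Fin N := ⟨l, hl⟩ with hLf
  obtain ⟨D, hD⟩ := exists_gramDet_eq_intCast b l hl.le
  have hD1 : 1 ≤ D := by rw [hD] at hd; exact_mod_cast hd
  obtain ⟨z, hz⟩ := exists_gsU_eq_intCast b (l + 1) hl i j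
  have hnum : ((uRec b l Lf Lf * uRec b l i j - uRec b l j Lf * uRec b l i Lf : ℤ) : ℝ) = D * z := by
    push_cast
    rw [hex Lf Lf, hex i j, hex j Lf, hex i Lf, gsU_self f Lf, gsU_self_right f j Lf,
      gsU_self_right f i Lf, ← hz, ← hD]
    have := gramDet_mul_gsU_succ f Lf i j
    rw [show gramDet f (↑Lf) (le_of_lt Lf.isLt) = gramDet f l hl.le from rfl] at this
    linarith [this]
  have hdenZ : dRec b l = D := by exact_mod_cast hden.trans hD
  have hnumZ : uRec b l Lf Lf * uRec b l i j - uRec b l j Lf * uRec b l i Lf = D * z := by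
    exact_mod_cast hnum
  have e1 : uRec b (l + 1) i j =
      (uRec b l Lf Lf * uRec b l i j - uRec b l j Lf * uRec b l i Lf) / dRec b l := uRec_succ b Lf i j
  rw [e1, hnumZ, hdenZ, Int.mul_ediv_cancel_left _ (by omega), ← hz]

/-- **Exactness one level past an independent prefix**: if the first `L < N` vectors are
independent, level `L + 1` of the recursion is exact too (only `dₖ ≥ 1` for `k ≤ L` is divided by).
[cite: Cohen1993, Algorithm 2.6.7] -/
theorem uRec_cast_eq_gsU_succ_prefix (b : Fin N → (Fin m → ℤ)) {L : ℕ} (hL : L < N)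
    (hli : LinearIndependent ℝ (⇑(intVecToEuclidean m).toAddMonoidHom ∘ (b ∘ Fin.castLE hL.le)))
    (i j : Fin N) :
    (uRec b (L + 1) i j : ℝ) = gsU (⇑(intVecToEuclidean m).toAddMonoidHom ∘ b) (L + 1) hL i j := by
  refine uRec_succ_cast_eq_gsU b hL (fun i j => uRec_cast_eq_gsU_of_prefix b hL.le hli L le_rfl i j)
    (dRec_cast_eq_gramDet_of_prefix b hL.le hli L le_rfl) ?_ i j
  have h := one_le_gramDet (b ∘ Fin.castLE hL.le) hli L le_rfl
  exact h

/-- **The level past a maximal independent prefix vanishes**: first `L` vectors independent, first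
`L + 1` dependent ⟹ `u_{L+1}(i, j) = 0` for all `i, j` (`u_{L+1} = d_{L+1} ⟪bᵢ, π_{L+1} bⱼ⟫` exactly,
and `d_{L+1} = 0`). [folklore] -/
theorem uRec_prefix_succ_eq_zero (b : Fin N → (Fin m → ℤ)) {L : ℕ} (hL : L < N)
    (hli : LinearIndependent ℝ (⇑(intVecToEuclidean m).toAddMonoidHom ∘ (b ∘ Fin.castLE hL.le)))
    (hdep : ¬ LinearIndependent ℝ (⇑(intVecToEuclidean m).toAddMonoidHom ∘ (b ∘ Fin.castLE (Nat.succ_le_of_lt hL))))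
    (i j : Fin N) : uRec b (L + 1) i j = 0 := by
  set f := ⇑(intVecToEuclidean m).toAddMonoidHom ∘ b with hf
  have h := uRec_cast_eq_gsU_succ_prefix b hL hli i j
  have hd0 : gramDet f (L + 1) hL = 0 := by
    have h1 := (linearIndependent_iff_gramDet_ne_zero (f ∘ Fin.castLE (Nat.succ_le_of_lt hL))).not.1 hdep
    push Not at h1
    rwa [gramDet_comp_castLE] at h1
  rw [gsU, hd0, zero_mul] at h
  exact_mod_cast h

/-- **Zero levels propagate.** [folklore] -/
theorem uRec_eq_zero_of_level_eq_zero (b : Fin N → (Fin m → ℤ)) {l : ℕ}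
    (h0 : ∀ i j : Fin N, uRec b l i j = 0) (i j : Fin N) : uRec b (l + 1) i j = 0 := by
  by_cases hl : l < N
  · rw [uRec_succ b ⟨l, hl⟩ i j, h0, h0, h0]
    simp
  · exact uRec_of_lt b (not_lt.1 hl) i j

/-- Zero levels propagate to all later levels. [folklore] -/
theorem uRec_eq_zero_of_le (b : Fin N → (Fin m → ℤ)) {l₀ l : ℕ} (hle : l₀ ≤ l)
    (h0 : ∀ i j : Fin N, uRec b l₀ i j = 0) (i j : Fin N) : uRec b l i j = 0 := by
  induction l, hle using Nat.le_induction generalizing i j with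
  | base => exact h0 i j
  | succ l _ ih => exact uRec_eq_zero_of_level_eq_zero b ih i j

/-! ### The universal size bound -/

/-- On an exact level, the table entries are bounded through Hadamard's inequality:
`|uₗ(i,j)| ≤ dₗ ‖bᵢ‖ ‖bⱼ‖ ≤ Bˡ · B`. [cite: LenstraLenstraLovasz1982, proof of Prop. 1.26] -/
theorem abs_uRec_le_pow_of_exact (b : Fin N → (Fin m → ℤ)) {l : ℕ} (hl : l ≤ N) {B : ℝ}
    (hB : ∀ k, ‖(⇑(intVecToEuclidean m).toAddMonoidHom ∘ b) k‖ ^ 2 ≤ B)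
    (hex : ∀ i j : Fin N, (uRec b l i j : ℝ) = gsU (⇑(intVecToEuclidean m).toAddMonoidHom ∘ b) l hl i j)
    (i j : Fin N) : |(uRec b l i j : ℝ)| ≤ B ^ (l + 1) := by
  set f := ⇑(intVecToEuclidean m).toAddMonoidHom ∘ b with hf
  have hB0 : 0 ≤ B := le_trans (sq_nonneg _) (hB i)
  rw [hex i j]
  refine (abs_gsU_le f l hl i j).trans ?_
  rw [pow_succ, mul_assoc]
  refine mul_le_mul (gramDet_le_pow f hB l hl) ?_ (by positivity) (pow_nonneg hB0 _)
  -- `‖bᵢ‖ ‖bⱼ‖ ≤ B`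
  have hi := hB i
  have hj := hB j
  nlinarith [norm_nonneg (f i), norm_nonneg (f j), sq_nonneg (‖f i‖ - ‖f j‖)]

/-- **Universal size bound for Cohen's table**: for every integer family with `‖bₖ‖² ≤ B` and all
`l, i, j`, `|uRec b l i j| ≤ B^{l+1}` — whether or not the family is independent (levels up to one
past the longest independent prefix are exact, the later ones vanish). [folklore] -/
theorem abs_uRec_le_pow (b : Fin N → (Fin m → ℤ)) {B : ℝ}
    (hB : ∀ k, ‖(⇑(intVecToEuclidean m).toAddMonoidHom ∘ b) k‖ ^ 2 ≤ B) (l : ℕ) (i j : Fin N) :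
    |(uRec b l i j : ℝ)| ≤ B ^ (l + 1) := by
  classical
  have hB0 : 0 ≤ B := le_trans (sq_nonneg _) (hB i)
  -- past level `N` everything is `0`
  by_cases hlN : N < l
  · obtain ⟨l', rfl⟩ : ∃ l', l = l' + 1 := ⟨l - 1, by omega⟩
    rw [uRec_of_lt b (by omega) i j]
    simp only [Int.cast_zero, abs_zero]
    positivity
  push Not at hlN
  -- `P k`: the first `k` vectors are independent
  let P : ℕ → Prop := fun k =>
    ∃ hk : k ≤ N, LinearIndependent ℝ (⇑(intVecToEuclidean m).toAddMonoidHom ∘ (b ∘ Fin.castLE hk))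
  have hP0 : P 0 := ⟨Nat.zero_le N, linearIndependent_empty_type⟩
  by_cases hind : P l
  · obtain ⟨hl, hli⟩ := hind
    exact abs_uRec_le_pow_of_exact b hl hB (fun i j => uRec_cast_eq_gsU_of_prefix b hl hli l le_rfl i j) i j
  · -- the first dependent prefix length `k₁ ≤ l`, `k₁ ≥ 1`
    have hex : ∃ k, ¬ P k := ⟨l, hind⟩
    set k₁ := Nat.find hex with hk₁
    have hk₁spec : ¬ P k₁ := Nat.find_spec hex
    have hk₁le : k₁ ≤ l := Nat.find_min' hex hind
    have hk₁pos : 0 < k₁ := by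
      rw [Nat.pos_iff_ne_zero]
      intro h0
      rw [h0] at hk₁spec
      exact hk₁spec hP0
    obtain ⟨L, hLk⟩ : ∃ L, k₁ = L + 1 := ⟨k₁ - 1, by omega⟩
    have hLind : P L := by
      by_contra h
      have := Nat.find_min' hex h
      omega
    obtain ⟨hLN, hliL⟩ := hLind
    have hLlt : L < N := by omega
    have hdep : ¬ LinearIndependent ℝ (⇑(intVecToEuclidean m).toAddMonoidHom ∘
        (b ∘ Fin.castLE (Nat.succ_le_of_lt hLlt))) := fun h => hk₁spec (hLk ▸ ⟨Nat.succ_le_of_lt hLlt, h⟩)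
    have hzero := uRec_prefix_succ_eq_zero b hLlt
      (by simpa using hliL) hdep
    rw [uRec_eq_zero_of_le b (show L + 1 ≤ l by omega) hzero i j]
    simp only [Int.cast_zero, abs_zero]
    positivity

/-- **Universal size bound for the `d`'s**: `|dRec b l| ≤ Bˡ` (`d₀ = 1`, `d_{l+1} = uₗ(l,l)`), for
`B ≥ 1`. [folklore] -/
theorem abs_dRec_le_pow (b : Fin N → (Fin m → ℤ)) {B : ℝ} (hB1 : 1 ≤ B)
    (hB : ∀ k, ‖(⇑(intVecToEuclidean m).toAddMonoidHom ∘ b) k‖ ^ 2 ≤ B) (l : ℕ) :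
    |(dRec b l : ℝ)| ≤ B ^ l := by
  cases l with
  | zero => simp [dRec]
  | succ l =>
    by_cases hl : l < N
    · simp only [dRec, dif_pos hl]
      exact abs_uRec_le_pow b hB l ⟨l, hl⟩ ⟨l, hl⟩
    · simp only [dRec, dif_neg hl, Int.cast_zero, abs_zero]
      positivity

end Literature.Algebra.EuclideanLattices
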